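import Summits.Ventures.LatticeQCDFlow.Scaling.DominatedStarMixingCeiling

/-!
HONEST FRAMING: exact (Metropolis-corrected) sampling algorithms for lattice gauge theory; figures
of merit are autocorrelation/cost numbers at stated couplings and volumes; no continuum-physics
claim.

# DominatedStarRetunedCeiling — RE-TUNING THE LYAPUNOV WEIGHT OF THE STALE HUB: FOR EVERY `b ∈ (0,p]` WITH
# `2t ≤ (1−t)w_0·b` THE MAP-ASSISTED HOT-REFRESHED HUB UNDER ONE-SIDED DOMINATION HAS `d(n) ≤ ((K+b)/b)(1 − tc(p−b)/m)ⁿ`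
# — THE RATE CONSTANT IMPROVES FROM `tcp/(2m)` TOWARDS `tcp/m` AS THE SWAP ODDS `t/((1−t)w_0)` DECREASE, AND THE REGIME
# WIDENS FROM `4t ≤ p(1−t)w_0` TO `2t < p(1−t)w_0`; WITH PERFECT TRANSPORTS, FOR EVERY `b ∈ (0,1]` WITH
# `(1−b)·t·(1 + c/m) ≤ (1−t)w_0·b`, `d(n) ≤ ((K+b)/b)(1 − tc(1−b)/m)ⁿ` — RATE `tch/(m(t+h)+tc)`, `h = (1−t)w_0`, AT THE
# OPTIMAL `b`, I.E. `t_mix ≲ ((K+t)/(t(1−t)))·log(K/ε)` FOR THE HOT-ONLY STAR AT `m = cK` (lean-2 GEN-26, ours)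

Venture-side (OURS).  Cell `lqcd-flow` (pub-lqcd), unit `pub-lqcd-lean-2-g26`, 2026-08-27.  Chapter M (the
coupon-collector ceiling without perfect transports), file 17.  Setting of `Scaling/DominatedStarMixingCeiling`.  The
drift lemma `RegenerationTagChain.regen_nonempty_le` holds for every weight `b` of the stale hub in the potential
`Φ(D) = b·𝟙{0 ∈ D} + #{k ∈ D : k ≠ 0}` subject to three linear conditions on the rate `ρ`; chapter M fixed `b = p/2`
(one-sided) and the analogous midpoint for perfect maps.  This file keeps `b` free: the stale hub dirties a clean
partner at rate `≤ t` and is refreshed at rate `h = (1−t)w_0`, so it is worth `b ≈ t/h` clean cold replicas, not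
`p/2`; with that weight the per-replica cleaning rate `tc(p−b)/m` is almost the full `tcp/m`.

## What is proved

* §0 **`hubWeight_worstTvDist_le` (MASTER FORM)** — both one-sided constants `p·μ_{l_r}(φ_r u) ≤ μ_0(u)`,
  `q·μ_0(u) ≤ μ_{l_r}(φ_r u)` (`0 < p ≤ 1`, `0 ≤ q ≤ 1`), any hub weight `0 < b ≤ p` and rate `ρ ≤ 1` satisfying the
  three drift conditions of `RegenerationTagChain.regen_nonempty_le` (`ρ ≤ tc(p−b)/m`,
  `ρb ≤ (1−t)w_0·b − t(1−qb)`, `ρ ≤ t(1−qb)c/m`): **`d(n) ≤ ((K+b)/b)·(1−ρ)ⁿ`**.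
* §1 **`retunedStar_worstTvDist_le`** — one-sided domination `p·μ_{l_r}(φ_r u) ≤ μ_0(u)` (`0 < p ≤ 1`), exact hot
  sampler, stationary cold kernels, multiplicities `≥ c`, ANY `b` with `0 < b ≤ p` and **`2t ≤ (1−t)w_0·b`**:
  **`d(n) ≤ ((K+b)/b)·(1 − tc(p−b)/m)ⁿ`**; `retunedStar_worstTvDist_le_of_ge_log`, **`retunedStar_mixingTime_le`** —
  `b < p`, `0 < t`: `t_mix(ε) ≤ ⌈(m/(tc(p−b)))·log((K+b)/(bε))⌉`.
* §2 **`twoSidedStar_worstTvDist_le`** — with the reverse constant `q`: ANY `b ∈ (0,p]` with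
  **`t·(1 + b(1−q)) ≤ (1−t)w_0·b`**: `d(n) ≤ ((K+b)/b)·(1 − tc(p−b)/m)ⁿ` (the reverse domination widens the regime;
  at `q = 1` it reads `t ≤ (1−t)w_0·b`).
* §3 **`retunedPerfectStar_worstTvDist_le`** — perfect transports, `0 < t`, ANY `b` with `0 < b ≤ 1` and
  **`(1−b)·t·(1 + c/m) ≤ (1−t)w_0·b`**: **`d(n) ≤ ((K+b)/b)·(1 − tc(1−b)/m)ⁿ`**;
  `retunedPerfectStar_worstTvDist_le_of_ge_log`, **`retunedPerfectStar_mixingTime_le`** (`b < 1`):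
  `t_mix(ε) ≤ ⌈(m/(tc(1−b)))·log((K+b)/(bε))⌉`.

Reading (no numerics implied): (one-sided) at `b = p/2` this is chapter M's ceiling; at `b = 2t/h` (admissible as
soon as `2t < p·h`) the rate is `tc(p − 2t/h)/m`, i.e. the full coupon rate `tcp/m` up to the swap odds, at the
price of `log(Kh/(2t))` in place of `log K`; (perfect) the admissible `b` closest to `0` is
`b* = t(m+c)/(t(m+c) + hm)`, giving the rate `tch/(m(t+h) + tc)` — for the hot-only star at `m = cK` this is
`t(1−t)/(K + t)`, so `t_mix(ε) ≤ ⌈((K+t)/(t(1−t)))·log((K+b*)/(b*ε))⌉` against the collector floor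
`(K/t − 1)·log(K/4)` of `Scaling/HubCollectorLaw`: the two sides now differ by the factor `1/(1−t)` (and the
logarithm's argument), not `2/(1−t)`.  NOT CLAIMED: that `1/(1−t)` is removable on either side (a stale hub passes
its content on before being refreshed with odds `t : h`, so the factor may be real on the ceiling side); anything
outside `2t < p(1−t)w_0` for imperfect maps; anything measured.  Literature grade (cell rule): OWN RESULT; nothing
cited as a fact; no new bib keys.
-/

noncomputable section

open Finset Function
open Literature.Probability.MarkovChains

namespace Summit.Ventures.LatticeQCDFlow.Scaling

variable {S : Type*} [Fintype S] [DecidableEq S] {K m : ℕ} {μ : Fin (K + 1) → S → ℝ} {M : Fin (K + 1) → S → S → ℝ}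
  {w : Fin (K + 1) → ℝ} {t p q : ℝ}

section Retuned
variable (κ : Fin m → Fin K) (φ : Fin m → Equiv.Perm S)

/-! ## §0 The master form: free hub weight `b` and rate `ρ` -/

/-- **MASTER FORM OF THE CEILING:** exact hot sampler, stationary cold kernels, hub multiplicities `c ≤ #{r : κ_r = p'}`,
the two one-sided dominations with constants `0 < p ≤ 1`, `0 ≤ q ≤ 1`, a hub weight `0 < b ≤ p` and a rate `ρ ≤ 1`
with `ρ ≤ tc(p−b)/m`, `ρb ≤ (1−t)w_0·b − t(1−qb)`, `ρ ≤ t(1−qb)c/m`: **`d(n) ≤ ((K+b)/b)·(1−ρ)ⁿ`.** [ours] -/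
theorem hubWeight_worstTvDist_le (hm : 1 ≤ m) (ht0 : 0 ≤ t) (ht1 : t ≤ 1) (hw0 : ∀ k, 0 ≤ w k)
    (hw1 : ∑ k, w k = 1) (hμ : ∀ k x, 0 < μ k x) (hμ1 : ∀ k, ∑ u, μ k u = 1) (hM : ∀ k, IsRowStochastic (M k))
    (hM0 : ∀ u v, M 0 u v = μ 0 v) (hstat : ∀ k : Fin (K + 1), k ≠ 0 → ∀ v, ∑ u, μ k u * M k u v = μ k v)
    (hp0 : 0 < p) (hp1 : p ≤ 1) (hq0 : 0 ≤ q) (hq1 : q ≤ 1) (hdom : ∀ r u, p * μ (κ r).succ (φ r u) ≤ μ 0 u)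
    (hrev : ∀ r u, q * μ 0 u ≤ μ (κ r).succ (φ r u))
    {c : ℕ} (hc : ∀ p' : Fin K, c ≤ (univ.filter (fun r : Fin m => κ r = p')).card)
    {b ρ : ℝ} (hb0 : 0 < b) (hbp : b ≤ p) (hρ1 : ρ ≤ 1) (h1 : ρ ≤ t * c * (p - b) / m)
    (h2 : ρ * b ≤ (1 - t) * w 0 * b - t * (1 - q * b)) (h3 : ρ ≤ t * (1 - q * b) * c / m) (n : ℕ) :
    worstTvDist (fun y z : Fin (K + 1) → S =>
        t * ptGraphSwap μ (fun r : Fin m => (((0 : Fin (K + 1)), (κ r).succ) : Fin (K + 1) × Fin (K + 1))) φ y z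
          + (1 - t) * prodKernel w M y z) (tensorFun μ) n
      ≤ ((K : ℝ) + b) / b * (1 - ρ) ^ n := by
  -- the hypothesis-equation objects of the chapter
  set α : Fin m → (Fin (K + 1) → S) → ℝ :=
    fun r z => min 1 (tensorFun μ (edgeFlowSwap (φ r) 0 (κ r).succ z) / tensorFun μ z) with hα_def
  have hα : ∀ r z, α r z = min 1 (tensorFun μ (edgeFlowSwap (φ r) 0 (κ r).succ z) / tensorFun μ z) := fun _ _ => rfl
  set β : Fin m → (Fin (K + 1) → S) → ℝ := fun r z => p * μ (κ r).succ (φ r (z 0)) / μ 0 (z 0) with hβ_def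
  have hβ : ∀ r z, β r z = p * μ (κ r).succ (φ r (z 0)) / μ 0 (z 0) := fun _ _ => rfl
  set β' : Fin m → (Fin (K + 1) → S) → ℝ :=
    fun r z => q * μ 0 ((φ r).symm (z (κ r).succ)) / μ (κ r).succ (z (κ r).succ) with hβ'_def
  have hβ' : ∀ r z, β' r z = q * μ 0 ((φ r).symm (z (κ r).succ)) / μ (κ r).succ (z (κ r).succ) := fun _ _ => rfl
  set γ : Fin m → (Fin (K + 1) → S) × Finset (Fin (K + 1)) → ℝ := fun r a =>
    if (0 : Fin (K + 1)) ∉ a.2 then (if (κ r).succ ∉ a.2 then α r a.1 else β r a.1)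
      else (if (κ r).succ ∉ a.2 then β' r a.1 else 0) with hγ_def
  have hγ : ∀ r a, γ r a = if (0 : Fin (K + 1)) ∉ a.2 then (if (κ r).succ ∉ a.2 then α r a.1 else β r a.1)
      else (if (κ r).succ ∉ a.2 then β' r a.1 else 0) := fun _ _ => rfl
  set gbar : Fin m → Finset (Fin (K + 1)) → ℝ := fun r D =>
    if (0 : Fin (K + 1)) ∉ D then (if (κ r).succ ∉ D then (1 : ℝ) else p) else (if (κ r).succ ∉ D then q else 0)
    with hg_def
  have hg : ∀ r D, gbar r D = if (0 : Fin (K + 1)) ∉ D then (if (κ r).succ ∉ D then (1 : ℝ) else p)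
      else (if (κ r).succ ∉ D then q else 0) := fun _ _ => rfl
  set Bset : Fin m → Finset (Fin (K + 1)) → Finset (Fin (K + 1)) := fun r D =>
    if (0 : Fin (K + 1)) ∉ D ∧ (κ r).succ ∉ D then D else insert (0 : Fin (K + 1)) (insert (κ r).succ D) with hB_def
  have hB : ∀ r D, Bset r D = if (0 : Fin (K + 1)) ∉ D ∧ (κ r).succ ∉ D then D
      else insert (0 : Fin (K + 1)) (insert (κ r).succ D) := fun _ _ => rfl
  set Ph : (Fin (K + 1) → S) × Finset (Fin (K + 1)) → (Fin (K + 1) → S) × Finset (Fin (K + 1)) → ℝ := fun a b =>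
    ∑ r : Fin m, t / m *
        (γ r a * (if b.1 = edgeFlowSwap (φ r) 0 (κ r).succ a.1 ∧ b.2 = a.2.image (Equiv.swap (0 : Fin (K + 1)) (κ r).succ)
            then (1 : ℝ) else 0)
          + (α r a.1 - γ r a) * (if b.1 = edgeFlowSwap (φ r) 0 (κ r).succ a.1 ∧ b.2 = Bset r a.2 then (1 : ℝ) else 0)
          + (1 - α r a.1) * (if b.1 = a.1 ∧ b.2 = Bset r a.2 then (1 : ℝ) else 0))
      + (1 - t) * ∑ k : Fin (K + 1), w k * (coordKernel M k a.1 b.1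
          * (if b.2 = (if k = 0 then a.2.erase 0 else a.2) then (1 : ℝ) else 0)) with hPh_def
  have hPh : ∀ a b, Ph a b = ∑ r : Fin m, t / m *
        (γ r a * (if b.1 = edgeFlowSwap (φ r) 0 (κ r).succ a.1 ∧ b.2 = a.2.image (Equiv.swap (0 : Fin (K + 1)) (κ r).succ)
            then (1 : ℝ) else 0)
          + (α r a.1 - γ r a) * (if b.1 = edgeFlowSwap (φ r) 0 (κ r).succ a.1 ∧ b.2 = Bset r a.2 then (1 : ℝ) else 0)
          + (1 - α r a.1) * (if b.1 = a.1 ∧ b.2 = Bset r a.2 then (1 : ℝ) else 0))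
      + (1 - t) * ∑ k : Fin (K + 1), w k * (coordKernel M k a.1 b.1
          * (if b.2 = (if k = 0 then a.2.erase 0 else a.2) then (1 : ℝ) else 0)) := fun _ _ => rfl
  set Q : Finset (Fin (K + 1)) → Finset (Fin (K + 1)) → ℝ := fun D D' => ∑ r : Fin m, t / m *
        (gbar r D * (if D' = D.image (Equiv.swap (0 : Fin (K + 1)) (κ r).succ) then (1 : ℝ) else 0)
          + (1 - gbar r D) * (if D' = Bset r D then (1 : ℝ) else 0))
      + (1 - t) * (w 0 * (if D' = D.erase 0 then (1 : ℝ) else 0) + (1 - w 0) * (if D' = D then (1 : ℝ) else 0)) with hQ_def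
  have hQ : ∀ D D', Q D D' = ∑ r : Fin m, t / m *
        (gbar r D * (if D' = D.image (Equiv.swap (0 : Fin (K + 1)) (κ r).succ) then (1 : ℝ) else 0)
          + (1 - gbar r D) * (if D' = Bset r D then (1 : ℝ) else 0))
      + (1 - t) * (w 0 * (if D' = D.erase 0 then (1 : ℝ) else 0) + (1 - w 0) * (if D' = D then (1 : ℝ) else 0)) :=
    fun _ _ => rfl
  have hw00 : 0 ≤ w 0 := hw0 0
  have hw01 : w 0 ≤ 1 := by
    have h := Finset.single_le_sum (f := w) (fun k _ => hw0 k) (mem_univ (0 : Fin (K + 1)))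
    rw [hw1] at h; exact h
  have htag := regen_nonempty_le κ hm ht0 ht1 hw00 hw01 hp1 hq0 hq1 hg hB hQ hc hb0 hbp hρ1 h1 h2 h3 n
  have hbound : 0 ≤ ((K : ℝ) + b) / b * (1 - ρ) ^ n := by
    have : 0 ≤ 1 - ρ := by linarith
    positivity
  refine Real.iSup_le (fun x => ?_) hbound
  refine (dom_tvDist_le_stale κ φ hm ht0 ht1 hw0 hw1 hμ hμ1 hM hM0 hstat hp0.le hp1 hq0 hq1 hdom hrev hα hβ hβ' hγ hg
    hB hPh hQ x n).trans (htag.trans (le_of_eq ?_))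
  ring

/-! ## §1 One-sided domination, free hub weight `b` -/

/-- **THE RETUNED CEILING UNDER ONE-SIDED DOMINATION:** `0 < p ≤ 1`, `p·μ_{l_r}(φ_r u) ≤ μ_0(u)`, exact hot sampler,
stationary cold kernels, hub multiplicities `c ≤ #{r : κ_r = p'}`, `c ≤ m`, and a hub weight `b` with `0 < b ≤ p`,
`2t ≤ (1−t)w_0·b`: **`d(n) ≤ ((K+b)/b)·(1 − tc(p−b)/m)ⁿ`.** [ours] -/
theorem retunedStar_worstTvDist_le (hm : 1 ≤ m) (ht0 : 0 ≤ t) (ht1 : t ≤ 1) (hw0 : ∀ k, 0 ≤ w k)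
    (hw1 : ∑ k, w k = 1) (hμ : ∀ k x, 0 < μ k x) (hμ1 : ∀ k, ∑ u, μ k u = 1) (hM : ∀ k, IsRowStochastic (M k))
    (hM0 : ∀ u v, M 0 u v = μ 0 v) (hstat : ∀ k : Fin (K + 1), k ≠ 0 → ∀ v, ∑ u, μ k u * M k u v = μ k v)
    (hp0 : 0 < p) (hp1 : p ≤ 1) (hdom : ∀ r u, p * μ (κ r).succ (φ r u) ≤ μ 0 u)
    {b : ℝ} (hb0 : 0 < b) (hbp : b ≤ p) (hreg : 2 * t ≤ (1 - t) * w 0 * b)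
    {c : ℕ} (hc : ∀ p' : Fin K, c ≤ (univ.filter (fun r : Fin m => κ r = p')).card) (hcm : c ≤ m) (n : ℕ) :
    worstTvDist (fun y z : Fin (K + 1) → S =>
        t * ptGraphSwap μ (fun r : Fin m => (((0 : Fin (K + 1)), (κ r).succ) : Fin (K + 1) × Fin (K + 1))) φ y z
          + (1 - t) * prodKernel w M y z) (tensorFun μ) n
      ≤ ((K : ℝ) + b) / b * (1 - t * c * (p - b) / m) ^ n := by
  have hrev : ∀ r u, (0 : ℝ) * μ 0 u ≤ μ (κ r).succ (φ r u) := fun r u => by rw [zero_mul]; exact (hμ _ _).le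
  have hmpos : (0 : ℝ) < m := Nat.cast_pos.mpr (by omega)
  have hcm' : (c : ℝ) ≤ m := by exact_mod_cast hcm
  have hc0 : (0 : ℝ) ≤ c := Nat.cast_nonneg c
  -- the three drift conditions at `ρ = tc(p−b)/m`, `q = 0`
  have hpb1 : p - b ≤ 1 := by linarith
  have hρt : t * c * (p - b) / m ≤ t := by
    rw [div_le_iff₀ hmpos]
    have : t * c * (p - b) ≤ t * m * 1 := by
      have h1 : c * (p - b) ≤ m * 1 := by nlinarith
      nlinarith
    linarith
  have hρ1 : t * c * (p - b) / m ≤ 1 := hρt.trans ht1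
  have h2 : t * c * (p - b) / m * b ≤ (1 - t) * w 0 * b - t * (1 - 0 * b) := by
    rw [zero_mul, sub_zero]
    have hb1 : b ≤ 1 := hbp.trans hp1
    have : t * c * (p - b) / m * b ≤ t * b := mul_le_mul_of_nonneg_right hρt hb0.le
    nlinarith
  have h3 : t * c * (p - b) / m ≤ t * (1 - 0 * b) * c / m := by
    rw [zero_mul, sub_zero, div_le_div_iff_of_pos_right hmpos]
    have hnn : 0 ≤ t * c * (1 - (p - b)) := mul_nonneg (mul_nonneg ht0 hc0) (by linarith)
    nlinarith [hnn]
  exact hubWeight_worstTvDist_le κ φ hm ht0 ht1 hw0 hw1 hμ hμ1 hM hM0 hstat hp0 hp1 le_rfl zero_le_one hdom hrev hc hb0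
    hbp hρ1 le_rfl h2 h3 n
/-- **`n ≥ (m/(tc(p−b)))·log((K+b)/(bε))` ⇒ `d(n) ≤ ε`** (`0 < t`, `b < p`). [ours] -/
theorem retunedStar_worstTvDist_le_of_ge_log (hm : 1 ≤ m) (ht0 : 0 < t) (ht1 : t ≤ 1) (hw0 : ∀ k, 0 ≤ w k)
    (hw1 : ∑ k, w k = 1) (hμ : ∀ k x, 0 < μ k x) (hμ1 : ∀ k, ∑ u, μ k u = 1) (hM : ∀ k, IsRowStochastic (M k))
    (hM0 : ∀ u v, M 0 u v = μ 0 v) (hstat : ∀ k : Fin (K + 1), k ≠ 0 → ∀ v, ∑ u, μ k u * M k u v = μ k v)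
    (hp0 : 0 < p) (hp1 : p ≤ 1) (hdom : ∀ r u, p * μ (κ r).succ (φ r u) ≤ μ 0 u)
    {b : ℝ} (hb0 : 0 < b) (hbp : b < p) (hreg : 2 * t ≤ (1 - t) * w 0 * b)
    {c : ℕ} (hc1 : 1 ≤ c) (hc : ∀ p' : Fin K, c ≤ (univ.filter (fun r : Fin m => κ r = p')).card) (hcm : c ≤ m)
    {ε : ℝ} (hε : 0 < ε) {n : ℕ} (hn : (m : ℝ) / (t * c * (p - b)) * Real.log (((K : ℝ) + b) / (b * ε)) ≤ n) :
    worstTvDist (fun y z : Fin (K + 1) → S =>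
        t * ptGraphSwap μ (fun r : Fin m => (((0 : Fin (K + 1)), (κ r).succ) : Fin (K + 1) × Fin (K + 1))) φ y z
          + (1 - t) * prodKernel w M y z) (tensorFun μ) n ≤ ε := by
  have hmpos : (0 : ℝ) < m := Nat.cast_pos.mpr (by omega)
  have hcpos : (0 : ℝ) < c := Nat.cast_pos.mpr (by omega)
  have hcm' : (c : ℝ) ≤ m := by exact_mod_cast hcm
  have hpb : 0 < p - b := by linarith
  refine (retunedStar_worstTvDist_le κ φ hm ht0.le ht1 hw0 hw1 hμ hμ1 hM hM0 hstat hp0 hp1 hdom hb0 hbp.le hreg hc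
    hcm n).trans ?_
  have ha0 : 0 < t * c * (p - b) / m := by positivity
  have ha1 : t * c * (p - b) / m ≤ 1 := by
    rw [div_le_one hmpos]
    have h1 : c * (p - b) ≤ m * 1 := by nlinarith
    nlinarith
  have hC : 0 < ((K : ℝ) + b) / b := by positivity
  refine geom_le_of_ge_log ha0 ha1 hC hε ?_
  have e1 : 1 / (t * c * (p - b) / m) = (m : ℝ) / (t * c * (p - b)) := by rw [one_div_div]
  have e2 : ((K : ℝ) + b) / b / ε = ((K : ℝ) + b) / (b * ε) := by rw [div_div]
  rw [e1, e2]; exact hn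

/-- **THE RETUNED MIXING CEILING: `t_mix(ε) ≤ ⌈(m/(tc(p−b)))·log((K+b)/(bε))⌉`** for every `b ∈ (0,p)` with
`2t ≤ (1−t)w_0·b` (`0 < t`). [ours] -/
theorem retunedStar_mixingTime_le (hm : 1 ≤ m) (ht0 : 0 < t) (ht1 : t ≤ 1) (hw0 : ∀ k, 0 ≤ w k)
    (hw1 : ∑ k, w k = 1) (hμ : ∀ k x, 0 < μ k x) (hμ1 : ∀ k, ∑ u, μ k u = 1) (hM : ∀ k, IsRowStochastic (M k))
    (hM0 : ∀ u v, M 0 u v = μ 0 v) (hstat : ∀ k : Fin (K + 1), k ≠ 0 → ∀ v, ∑ u, μ k u * M k u v = μ k v)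
    (hp0 : 0 < p) (hp1 : p ≤ 1) (hdom : ∀ r u, p * μ (κ r).succ (φ r u) ≤ μ 0 u)
    {b : ℝ} (hb0 : 0 < b) (hbp : b < p) (hreg : 2 * t ≤ (1 - t) * w 0 * b)
    {c : ℕ} (hc1 : 1 ≤ c) (hc : ∀ p' : Fin K, c ≤ (univ.filter (fun r : Fin m => κ r = p')).card) (hcm : c ≤ m)
    {ε : ℝ} (hε : 0 < ε) :
    mixingTime (fun y z : Fin (K + 1) → S =>
        t * ptGraphSwap μ (fun r : Fin m => (((0 : Fin (K + 1)), (κ r).succ) : Fin (K + 1) × Fin (K + 1))) φ y z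
          + (1 - t) * prodKernel w M y z) (tensorFun μ) ε
      ≤ ⌈(m : ℝ) / (t * c * (p - b)) * Real.log (((K : ℝ) + b) / (b * ε))⌉₊ :=
  mixingTime_le _ _ (retunedStar_worstTvDist_le_of_ge_log κ φ hm ht0 ht1 hw0 hw1 hμ hμ1 hM hM0 hstat hp0 hp1 hdom hb0 hbp
    hreg hc1 hc hcm hε (Nat.le_ceil _))

/-! ## §2 Both one-sided constants, free hub weight `b` -/

/-- **THE RETUNED CEILING WITH THE REVERSE CONSTANT `q`:** `p·μ_{l_r}(φ_r u) ≤ μ_0(u)`, `q·μ_0(u) ≤ μ_{l_r}(φ_r u)`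
(`0 < p ≤ 1`, `0 ≤ q ≤ 1`), and a hub weight `b` with `0 < b ≤ p`, **`t·(1 + b(1−q)) ≤ (1−t)w_0·b`**:
**`d(n) ≤ ((K+b)/b)·(1 − tc(p−b)/m)ⁿ`** — reverse domination widens the admissible swap fraction. [ours] -/
theorem twoSidedStar_worstTvDist_le (hm : 1 ≤ m) (ht0 : 0 ≤ t) (ht1 : t ≤ 1) (hw0 : ∀ k, 0 ≤ w k)
    (hw1 : ∑ k, w k = 1) (hμ : ∀ k x, 0 < μ k x) (hμ1 : ∀ k, ∑ u, μ k u = 1) (hM : ∀ k, IsRowStochastic (M k))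
    (hM0 : ∀ u v, M 0 u v = μ 0 v) (hstat : ∀ k : Fin (K + 1), k ≠ 0 → ∀ v, ∑ u, μ k u * M k u v = μ k v)
    (hp0 : 0 < p) (hp1 : p ≤ 1) (hq0 : 0 ≤ q) (hq1 : q ≤ 1) (hdom : ∀ r u, p * μ (κ r).succ (φ r u) ≤ μ 0 u)
    (hrev : ∀ r u, q * μ 0 u ≤ μ (κ r).succ (φ r u))
    {b : ℝ} (hb0 : 0 < b) (hbp : b ≤ p) (hreg : t * (1 + b * (1 - q)) ≤ (1 - t) * w 0 * b)
    {c : ℕ} (hc : ∀ p' : Fin K, c ≤ (univ.filter (fun r : Fin m => κ r = p')).card) (hcm : c ≤ m) (n : ℕ) :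
    worstTvDist (fun y z : Fin (K + 1) → S =>
        t * ptGraphSwap μ (fun r : Fin m => (((0 : Fin (K + 1)), (κ r).succ) : Fin (K + 1) × Fin (K + 1))) φ y z
          + (1 - t) * prodKernel w M y z) (tensorFun μ) n
      ≤ ((K : ℝ) + b) / b * (1 - t * c * (p - b) / m) ^ n := by
  have hmpos : (0 : ℝ) < m := Nat.cast_pos.mpr (by omega)
  have hcm' : (c : ℝ) ≤ m := by exact_mod_cast hcm
  have hc0 : (0 : ℝ) ≤ c := Nat.cast_nonneg c
  have hb1 : b ≤ 1 := hbp.trans hp1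
  have hqb : q * b ≤ 1 := by nlinarith
  have hpb1 : p - b ≤ 1 := by linarith
  have hρt : t * c * (p - b) / m ≤ t := by
    rw [div_le_iff₀ hmpos]
    have : t * c * (p - b) ≤ t * m * 1 := by
      have h1 : c * (p - b) ≤ m * 1 := by nlinarith
      nlinarith
    linarith
  have hρ1 : t * c * (p - b) / m ≤ 1 := hρt.trans ht1
  have h2 : t * c * (p - b) / m * b ≤ (1 - t) * w 0 * b - t * (1 - q * b) := by
    have : t * c * (p - b) / m * b ≤ t * b := mul_le_mul_of_nonneg_right hρt hb0.le
    nlinarith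
  have h3 : t * c * (p - b) / m ≤ t * (1 - q * b) * c / m := by
    rw [div_le_div_iff_of_pos_right hmpos]
    -- `p − b ≤ 1 − qb` since `b(1 − q) ≥ 0`... and `p ≤ 1`
    have hnn : 0 ≤ t * c * ((1 - q * b) - (p - b)) := mul_nonneg (mul_nonneg ht0 hc0) (by nlinarith)
    nlinarith [hnn]
  exact hubWeight_worstTvDist_le κ φ hm ht0 ht1 hw0 hw1 hμ hμ1 hM hM0 hstat hp0 hp1 hq0 hq1 hdom hrev hc hb0 hbp hρ1
    le_rfl h2 h3 n

/-! ## §3 Perfect transports, free hub weight `b` -/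

/-- **THE RETUNED CEILING WITH PERFECT TRANSPORTS:** `μ_{l_r}(φ_r u) = μ_0(u)`, `0 < t ≤ 1`, exact hot sampler,
stationary cold kernels, multiplicities `≥ c`, and a hub weight `b` with `0 < b ≤ 1` and
`(1−b)·t·(1 + c/m) ≤ (1−t)w_0·b`: **`d(n) ≤ ((K+b)/b)·(1 − tc(1−b)/m)ⁿ`.** [ours] -/
theorem retunedPerfectStar_worstTvDist_le (hm : 1 ≤ m) (ht0 : 0 < t) (ht1 : t ≤ 1) (hw0 : ∀ k, 0 ≤ w k)
    (hw1 : ∑ k, w k = 1) (hμ : ∀ k x, 0 < μ k x) (hμ1 : ∀ k, ∑ u, μ k u = 1) (hM : ∀ k, IsRowStochastic (M k))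
    (hM0 : ∀ u v, M 0 u v = μ 0 v) (hstat : ∀ k : Fin (K + 1), k ≠ 0 → ∀ v, ∑ u, μ k u * M k u v = μ k v)
    (hperf : ∀ r u, μ (κ r).succ (φ r u) = μ 0 u)
    {c : ℕ} (hc : ∀ p' : Fin K, c ≤ (univ.filter (fun r : Fin m => κ r = p')).card) (hcm : c ≤ m)
    {b : ℝ} (hb0 : 0 < b) (hb1 : b ≤ 1) (hreg : (1 - b) * t * (1 + (c : ℝ) / m) ≤ (1 - t) * w 0 * b) (n : ℕ) :
    worstTvDist (fun y z : Fin (K + 1) → S =>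
        t * ptGraphSwap μ (fun r : Fin m => (((0 : Fin (K + 1)), (κ r).succ) : Fin (K + 1) × Fin (K + 1))) φ y z
          + (1 - t) * prodKernel w M y z) (tensorFun μ) n
      ≤ ((K : ℝ) + b) / b * (1 - t * c * (1 - b) / m) ^ n := by
  have hdom : ∀ r u, (1 : ℝ) * μ (κ r).succ (φ r u) ≤ μ 0 u := fun r u => by rw [one_mul, hperf]
  have hrev : ∀ r u, (1 : ℝ) * μ 0 u ≤ μ (κ r).succ (φ r u) := fun r u => by rw [one_mul, hperf]
  have hmpos : (0 : ℝ) < m := Nat.cast_pos.mpr (by omega)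
  have hcm' : (c : ℝ) ≤ m := by exact_mod_cast hcm
  have hc0 : (0 : ℝ) ≤ c := Nat.cast_nonneg c
  -- the three drift conditions at `ρ = tc(1−b)/m`, `p = q = 1`
  have hρt : t * c * (1 - b) / m ≤ t := by
    rw [div_le_iff₀ hmpos]
    have h1 : c * (1 - b) ≤ m * 1 := by nlinarith
    nlinarith
  have hρ1 : t * c * (1 - b) / m ≤ 1 := hρt.trans ht1
  have h2 : t * c * (1 - b) / m * b ≤ (1 - t) * w 0 * b - t * (1 - 1 * b) := by
    rw [one_mul]
    have hkey : t * c * (1 - b) / m * b + t * (1 - b) ≤ (1 - b) * t * (1 + c / m) := by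
      have e : (1 - b) * t * (1 + c / m) = t * c * (1 - b) / m * 1 + t * (1 - b) := by
        field_simp
        ring
      rw [e]
      have : t * c * (1 - b) / m * b ≤ t * c * (1 - b) / m * 1 :=
        mul_le_mul_of_nonneg_left hb1 (by positivity)
      linarith
    linarith
  have h3 : t * c * (1 - b) / m ≤ t * (1 - 1 * b) * c / m := by
    rw [one_mul, div_le_div_iff_of_pos_right hmpos]
    nlinarith
  exact hubWeight_worstTvDist_le κ φ hm ht0.le ht1 hw0 hw1 hμ hμ1 hM hM0 hstat zero_lt_one le_rfl zero_le_one le_rfl hdom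
    hrev hc hb0 hb1 hρ1 le_rfl h2 h3 n

/-- **`n ≥ (m/(tc(1−b)))·log((K+b)/(bε))` ⇒ `d(n) ≤ ε`** with perfect transports (`b < 1`). [ours] -/
theorem retunedPerfectStar_worstTvDist_le_of_ge_log (hm : 1 ≤ m) (ht0 : 0 < t) (ht1 : t ≤ 1) (hw0 : ∀ k, 0 ≤ w k)
    (hw1 : ∑ k, w k = 1) (hμ : ∀ k x, 0 < μ k x) (hμ1 : ∀ k, ∑ u, μ k u = 1) (hM : ∀ k, IsRowStochastic (M k))
    (hM0 : ∀ u v, M 0 u v = μ 0 v) (hstat : ∀ k : Fin (K + 1), k ≠ 0 → ∀ v, ∑ u, μ k u * M k u v = μ k v)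
    (hperf : ∀ r u, μ (κ r).succ (φ r u) = μ 0 u)
    {c : ℕ} (hc1 : 1 ≤ c) (hc : ∀ p' : Fin K, c ≤ (univ.filter (fun r : Fin m => κ r = p')).card) (hcm : c ≤ m)
    {b : ℝ} (hb0 : 0 < b) (hb1 : b < 1) (hreg : (1 - b) * t * (1 + (c : ℝ) / m) ≤ (1 - t) * w 0 * b)
    {ε : ℝ} (hε : 0 < ε) {n : ℕ} (hn : (m : ℝ) / (t * c * (1 - b)) * Real.log (((K : ℝ) + b) / (b * ε)) ≤ n) :
    worstTvDist (fun y z : Fin (K + 1) → S =>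
        t * ptGraphSwap μ (fun r : Fin m => (((0 : Fin (K + 1)), (κ r).succ) : Fin (K + 1) × Fin (K + 1))) φ y z
          + (1 - t) * prodKernel w M y z) (tensorFun μ) n ≤ ε := by
  have hmpos : (0 : ℝ) < m := Nat.cast_pos.mpr (by omega)
  have hcpos : (0 : ℝ) < c := Nat.cast_pos.mpr (by omega)
  have hcm' : (c : ℝ) ≤ m := by exact_mod_cast hcm
  have h1b : 0 < 1 - b := by linarith
  refine (retunedPerfectStar_worstTvDist_le κ φ hm ht0 ht1 hw0 hw1 hμ hμ1 hM hM0 hstat hperf hc hcm hb0 hb1.le hreg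
    n).trans ?_
  have ha0 : 0 < t * c * (1 - b) / m := by positivity
  have ha1 : t * c * (1 - b) / m ≤ 1 := by
    rw [div_le_one hmpos]
    have h1 : c * (1 - b) ≤ m * 1 := by nlinarith
    nlinarith
  have hC : 0 < ((K : ℝ) + b) / b := by positivity
  refine geom_le_of_ge_log ha0 ha1 hC hε ?_
  have e1 : 1 / (t * c * (1 - b) / m) = (m : ℝ) / (t * c * (1 - b)) := by rw [one_div_div]
  have e2 : ((K : ℝ) + b) / b / ε = ((K : ℝ) + b) / (b * ε) := by rw [div_div]
  rw [e1, e2]; exact hn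

/-- **THE RETUNED MIXING CEILING WITH PERFECT TRANSPORTS: `t_mix(ε) ≤ ⌈(m/(tc(1−b)))·log((K+b)/(bε))⌉`** for every
`b ∈ (0,1)` with `(1−b)·t·(1 + c/m) ≤ (1−t)w_0·b`. [ours] -/
theorem retunedPerfectStar_mixingTime_le (hm : 1 ≤ m) (ht0 : 0 < t) (ht1 : t ≤ 1) (hw0 : ∀ k, 0 ≤ w k)
    (hw1 : ∑ k, w k = 1) (hμ : ∀ k x, 0 < μ k x) (hμ1 : ∀ k, ∑ u, μ k u = 1) (hM : ∀ k, IsRowStochastic (M k))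
    (hM0 : ∀ u v, M 0 u v = μ 0 v) (hstat : ∀ k : Fin (K + 1), k ≠ 0 → ∀ v, ∑ u, μ k u * M k u v = μ k v)
    (hperf : ∀ r u, μ (κ r).succ (φ r u) = μ 0 u)
    {c : ℕ} (hc1 : 1 ≤ c) (hc : ∀ p' : Fin K, c ≤ (univ.filter (fun r : Fin m => κ r = p')).card) (hcm : c ≤ m)
    {b : ℝ} (hb0 : 0 < b) (hb1 : b < 1) (hreg : (1 - b) * t * (1 + (c : ℝ) / m) ≤ (1 - t) * w 0 * b)
    {ε : ℝ} (hε : 0 < ε) :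
    mixingTime (fun y z : Fin (K + 1) → S =>
        t * ptGraphSwap μ (fun r : Fin m => (((0 : Fin (K + 1)), (κ r).succ) : Fin (K + 1) × Fin (K + 1))) φ y z
          + (1 - t) * prodKernel w M y z) (tensorFun μ) ε
      ≤ ⌈(m : ℝ) / (t * c * (1 - b)) * Real.log (((K : ℝ) + b) / (b * ε))⌉₊ :=
  mixingTime_le _ _ (retunedPerfectStar_worstTvDist_le_of_ge_log κ φ hm ht0 ht1 hw0 hw1 hμ hμ1 hM hM0 hstat hperf hc1
    hc hcm hb0 hb1 hreg hε (Nat.le_ceil _))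

end Retuned

end Summit.Ventures.LatticeQCDFlow.Scaling

end
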